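import Literature.Analysis.FluidPDE.TimeDependentLinearFlow
import Literature.Analysis.FluidPDE.KNSSRemark61
import HarnessLib

/-!
# Route `AngularGalerkinLadder` · K3 `LimitTransfer`: the Type-I decay hypothesis of the forced
# Oseen-mild remainder bound is load-bearing (KILLSHEET row KJ-25)

Cell `ns-blowup`, refuter lineage `ns-blowup-refuter` (g14); Negative lane,
`--supports stmt-NavierStokesRegularity-19961`. Only Literature modules are imported; nothing here
asserts a Theses declaration.

`Theorems/AngularGalerkinLadderLimitTransferOfRemainder.lean` (ns-blowup-lean g11, p481922 /
p482639) reduces K3 `LimitTransfer` to ONE analytic statement `hA′`, the hypothesis of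
`angularGalerkinLadder_limitTransfer_of_remainder'`: for every classical solution `(u, p)` of
Navier–Stokes (`ν = 1`) on `(−∞, 0) × ℝ³` with force `d`, Type-I spatial decay
`‖u t x‖ ≤ C₀ / (‖x‖ + √(−t))` (`HasTypeIDecay C₀ u`) and defect `‖d t x‖ ≤ ε / (‖x‖ + √(−t))³`,
the forced Oseen-mild remainder `ρ(s,t)(x) = u t x − e^{(t−s)Δ}(u s) x + B¹_s(u,u)(t) x` is bounded
by `ε · K s t` (and by `ε · Φ t · √(t − s)` on lags `≤ 1`).

This file records, kernel-checked, that the decay hypothesis cannot be deleted from `hA′`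
(`remainderBound_false_without_decay`, whose type is `¬ (hA′ with HasTypeIDecay deleted and the
then-idle ∀ C₀ dropped)`, written inline): the Serrin / KNSS parasitic drift `u(t, x) = t e₀`,
`p(t, x) = −⟪e₀, x⟫`, `d = 0` is a classical solution on `(−∞, 0)` with defect `ε = 0`
(`isClassicalNSSolutionOn_drift`, from `LinearFlow.isClassicalNSSolutionOn` with `S = 0`), but its remainder between `s = −2` and `t = −1`
is `ρ = (−1)e₀ − e^{Δ}((−2)e₀) + 0 = e₀ ≠ 0` (`UnboundedOperators.heatExtension_const`,
`oseenDuhamel_eq_zero_of_const`), whereas `hA′` without decay demands `‖ρ‖ ≤ 0 · K = 0`. In print: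
Koch–Nadirashvili–Seregin–Šverák 2009, §3 ("parasitic solutions" `u = b(t)`, `p = −b′(t)·x`, which
Lemma 3.1's term `b(t)` accounts for) and Remark 6.1 (a mild solution of the form `b(t)` is
constant); the decay hypothesis is exactly what forces `b ≡ 0` in the gauge fixing (KILLSHEET KJ-22 /
KJ-24). No claim on any item is taken here.

References: G. Koch, N. Nadirashvili, G. Seregin, V. Šverák, Acta Math. 203 (2009) 83–105 =
arXiv:0709.3599, §3 p. 6–7 (parasitic solutions, Lemma 3.1), Remark 6.1 p. 11.
[KochNadirashviliSereginSverak2009]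
-/

noncomputable section

open Set

namespace Summit.NavierStokesRegularity.LimitTransferRemainderBoundWithoutDecay

open Literature.Analysis.FluidPDE

/-- The drift is a classical Navier–Stokes solution on `(−∞, 0)` with zero force (any viscosity):
`u(t, x) = t e₀` (`e₀ = (1, 0, 0)`), in the `LinearFlow` normal form with zero linear part and pressure
`p(t, x) = −⟪e₀, x⟫`.
[cite: KochNadirashviliSereginSverak2009, §3 p. 7, parasitic solutions (arXiv:0709.3599)] -/
theorem isClassicalNSSolutionOn_drift (ν : ℝ) :
    IsClassicalNSSolutionOn (Iio 0) ν (fun _ _ => (0 : EuclideanSpace ℝ (Fin 3)))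
      (LinearFlow.velocity (fun _ => (0 : EuclideanSpace ℝ (Fin 3) →L[ℝ] EuclideanSpace ℝ (Fin 3)))
        (fun t => t • EuclideanSpace.single 0 1))
      (LinearFlow.pressure (fun _ => (0 : EuclideanSpace ℝ (Fin 3) →L[ℝ] EuclideanSpace ℝ (Fin 3)))
        (fun _ => 0) (fun t => t • EuclideanSpace.single 0 1) (fun _ => EuclideanSpace.single 0 1)
        (fun _ => 0)) := by
  have h := LinearFlow.isClassicalNSSolutionOn (E := EuclideanSpace ℝ (Fin 3))
    (S := fun _ => (0 : EuclideanSpace ℝ (Fin 3) →L[ℝ] EuclideanSpace ℝ (Fin 3)))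
    (S' := fun _ => 0) (U₀ := fun t => t • EuclideanSpace.single 0 1)
    (U₀' := fun _ => EuclideanSpace.single 0 1) (f := fun _ => 0)
    (uniqueDiffOn_Iio 0) ν contDiffOn_const contDiffOn_const
    (contDiffOn_id.smul contDiffOn_const) contDiffOn_const contDiffOn_const
    (fun t _ => hasDerivWithinAt_const t _ _)
    (fun t _ => (((hasDerivWithinAt_id t (Iio (0 : ℝ))).smul_const
        (EuclideanSpace.single 0 1 : EuclideanSpace ℝ (Fin 3))).congr_deriv (one_smul ℝ _)))
    (fun t _ => by simp) (fun t _ x y => by simp [LinearFlow.ccMatrix])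
  exact h

/-- **KJ-25: the Type-I decay hypothesis of `hA′` is load-bearing.** The negated statement is the
hypothesis `hA′` of `angularGalerkinLadder_limitTransfer_of_remainder'` with `HasTypeIDecay C₀ u`
deleted (and the then-idle `∀ C₀` dropped): a forced Oseen-mild remainder bound `‖ρ‖ ≤ ε · K s t` for
EVERY classical solution on `(−∞, 0)` with defect weight `ε / (‖x‖ + √(−t))³`. It fails for the
parasitic drift `u = t e₀`, `d = 0`, `ε = 0`: between `s = −2` and `t = −1` the remainder is `e₀ ≠ 0`.
[cite: KochNadirashviliSereginSverak2009, Remark 6.1 (arXiv:0709.3599, p. 11)] -/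
theorem remainderBound_false_without_decay :
    ¬ ∃ (Φ : ℝ → ℝ) (K : ℝ → ℝ → ℝ), MonotoneOn Φ (Iio 0) ∧ (∀ τ < 0, 0 ≤ Φ τ) ∧
      ∀ (ε : ℝ) (u : ℝ → EuclideanSpace ℝ (Fin 3) → EuclideanSpace ℝ (Fin 3))
        (p : ℝ → EuclideanSpace ℝ (Fin 3) → ℝ)
        (d : ℝ → EuclideanSpace ℝ (Fin 3) → EuclideanSpace ℝ (Fin 3)),
        IsClassicalNSSolutionOn (Iio 0) 1 d u p →
          (∀ t < 0, ∀ x, ‖d t x‖ ≤ ε / (‖x‖ + Real.sqrt (-t)) ^ 3) → 0 ≤ ε →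
            ∀ s t : ℝ, s < t → t < 0 → ∀ x,
              ‖u t x - Literature.Analysis.UnboundedOperators.heatExtension (u s) (t - s) x +
                  oseenDuhamel 1 s u u t x‖ ≤ ε * K s t ∧
                (t - s ≤ 1 →
                  ‖u t x - Literature.Analysis.UnboundedOperators.heatExtension (u s) (t - s) x +
                      oseenDuhamel 1 s u u t x‖ ≤ ε * Φ t * Real.sqrt (t - s)) := by
  rintro ⟨Φ, K, -, -, h⟩
  obtain ⟨h1, -⟩ := h 0 _ _ _ (isClassicalNSSolutionOn_drift 1)
    (fun t _ x => by simp) le_rfl (-2) (-1) (by norm_num) (by norm_num) 0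
  have hval : ∀ (τ : ℝ) (y : EuclideanSpace ℝ (Fin 3)),
      LinearFlow.velocity (fun _ => (0 : EuclideanSpace ℝ (Fin 3) →L[ℝ] EuclideanSpace ℝ (Fin 3)))
        (fun t => t • EuclideanSpace.single 0 1) τ y = τ • EuclideanSpace.single 0 1 :=
    fun τ y => by simp [LinearFlow.velocity]
  have hu2 : LinearFlow.velocity
      (fun _ => (0 : EuclideanSpace ℝ (Fin 3) →L[ℝ] EuclideanSpace ℝ (Fin 3)))
      (fun t => t • EuclideanSpace.single 0 1) (-2) =
      fun _ => (-2 : ℝ) • (EuclideanSpace.single 0 1 : EuclideanSpace ℝ (Fin 3)) :=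
    funext fun y => hval _ y
  have hconst : ∀ τ ∈ Ioo (-2 : ℝ) (-1), ∀ y : EuclideanSpace ℝ (Fin 3),
      LinearFlow.velocity (fun _ => (0 : EuclideanSpace ℝ (Fin 3) →L[ℝ] EuclideanSpace ℝ (Fin 3)))
        (fun t => t • EuclideanSpace.single 0 1) τ y = τ • EuclideanSpace.single 0 1 :=
    fun τ _ y => hval τ y
  rw [hu2, Literature.Analysis.UnboundedOperators.heatExtension_const _ (by norm_num),
    oseenDuhamel_eq_zero_of_const hconst hconst, hval, add_zero, ← sub_smul, zero_mul] at h1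
  norm_num at h1

end Summit.NavierStokesRegularity.LimitTransferRemainderBoundWithoutDecay
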